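import Mathlib
import Summits.Ventures.DiscreteObjects.Mahler.CyclotomicIntegerMeasure
import Summits.Ventures.DiscreteObjects.Mahler.SymmetricRootIntegrality
import Summits.Ventures.DiscreteObjects.Mahler.LehmerExactMeasure
import Summits.Ventures.DiscreteObjects.Mahler.SubLehmerDegree56

/-!
# Lehmer's conjecture for cyclotomic integers of conductor prime to a small prime (venture `DiscreteObjects`, target L)

Cell `pub-namedobj`, seat `pub-namedobj-mahler-g27`. Framing: lottery ticket; floor = certified bounds/negative ranges.

[cite: BombieriGubler2001, Theorem 4.4.9, Case I] (Amoroso–Dvornicich 2000) in Mahler-measure form: **for a cyclotomic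
integer `α = g(ζ_m)`, `g ∈ ℤ[X]`, `ζ_m` a primitive `m`-th root of unity, `α ≠ 0` and not a root of unity, and a prime `p`
not dividing `m`: `M(α)^{p+1} ≥ (p/2)^{deg α}`** (`cyclotomicInteger_lehmer_bound`; `M(α) = M(minpoly_ℤ α)`), i.e.
`h(α) ≥ log(p/2)/(p+1)`.  Translation from `CyclotomicIntegerMeasure`: the polynomial `F = ∏_μ (X - g(μ))` over the
primitive `m`-th roots of unity has integer coefficients (symmetric functions of the roots of `Φ_m`,
`SymmetricRootIntegrality`), all its roots are roots of the irreducible `f = minpoly_ℤ α` (irreducibility of `Φ_m`), hence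
`F = f^e` with `e · deg f = φ(m)` (`eq_pow_of_roots_subset`), and `M(F) = ∏_μ max(1,|g(μ)|)`.
Consequences: with `p = 3` (`3 ∤ m`), `M(α) ≥ (3/2)^{deg α/4}`, so **every cyclotomic integer of the field `ℚ(ζ_m)`,
`3 ∤ m`, which is not `0`, `±1`-free… precisely: not `0` and not a root of unity, has `M(α) > M(ℓ)` = Lehmer's number**
(`lehmer_of_cyclotomicInteger_three`: degree `≥ 2` gives `M ≥ (9/4)^{1/4} = 1.2247…`, degree `1` gives `|α| ≥ 2`); the same
with `p = 5` for `5 ∤ m` (`lehmer_of_cyclotomicInteger_five`).  REPLICATION, no new mathematics.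
-/

namespace Summit.Ventures.DiscreteObjects.Mahler

open Polynomial Finset

/-- Mahler measure of a product of linear factors. -/
theorem mahlerMeasure_prod_X_sub_C (s : Finset ℂ) (a : ℂ → ℂ) :
    (∏ x ∈ s, (X - C (a x))).mahlerMeasure = ∏ x ∈ s, max 1 ‖a x‖ := by
  classical
  induction s using Finset.induction_on with
  | empty => simp [mahlerMeasure_one]
  | insert x s hx ih => rw [Finset.prod_insert hx, Finset.prod_insert hx, mahlerMeasure_mul, mahlerMeasure_X_sub_C, ih]

/-- `M(f^e) = M(f)^e` for `f ∈ ℤ[X]`. -/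
theorem intMahlerMeasure_pow (f : ℤ[X]) (e : ℕ) : intMahlerMeasure (f ^ e) = intMahlerMeasure f ^ e := by
  induction e with
  | zero =>
    rw [pow_zero, pow_zero]
    unfold intMahlerMeasure
    rw [Polynomial.map_one, mahlerMeasure_one]
  | succ e ih => rw [pow_succ, intMahlerMeasure_mul, ih, pow_succ]

/-- **Powers of a minimal polynomial.**  A monic `P ∈ ℤ[X]` all of whose complex roots are roots of a monic
irreducible `f ∈ ℤ[X]` is a power of `f`. -/
theorem eq_pow_of_roots_subset {f : ℤ[X]} (hfmon : f.Monic) (hfirr : Irreducible f) :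
    ∀ n : ℕ, ∀ P : ℤ[X], P.natDegree = n → P.Monic →
      (∀ z : ℂ, z ∈ (P.map (Int.castRingHom ℂ)).roots → aeval z f = 0) → ∃ e : ℕ, P = f ^ e := by
  intro n
  induction n using Nat.strong_induction_on with
  | _ n ih =>
    intro P hPn hPmon hroots
    by_cases hn : n = 0
    · refine ⟨0, ?_⟩
      rw [pow_zero]
      exact Polynomial.eq_one_of_monic_natDegree_zero hPmon (hPn.trans hn)
    · have hfdeg : 0 < f.natDegree :=
        (Monic.natDegree_pos hfmon).2 (fun h => hfirr.not_isUnit (h ▸ isUnit_one))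
      have hPC0 : P.map (Int.castRingHom ℂ) ≠ 0 := (hPmon.map _).ne_zero
      have hPCdeg : (P.map (Int.castRingHom ℂ)).degree ≠ 0 := by
        rw [degree_eq_natDegree hPC0, natDegree_map_eq_of_injective (Int.castRingHom ℂ).injective_int, hPn]
        exact_mod_cast hn
      obtain ⟨z, hz⟩ := IsAlgClosed.exists_root _ hPCdeg
      have hzmem : z ∈ (P.map (Int.castRingHom ℂ)).roots := (mem_roots hPC0).2 hz
      have hfz : aeval z f = 0 := hroots z hzmem
      have hPz : aeval z P = 0 := by
        have h := hz
        rwa [IsRoot.def, eval_map, ← algebraMap_int_eq, ← aeval_def] at h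
      -- `f ∣ P` over `ℚ`, then over `ℤ`
      have hfQ : Irreducible (f.map (algebraMap ℤ ℚ)) :=
        ((hfirr.isPrimitive hfdeg.ne').irreducible_iff_irreducible_map_fraction_map (K := ℚ)).mp hfirr
      have hmin : minpoly ℚ z = f.map (algebraMap ℤ ℚ) :=
        (minpoly.eq_of_irreducible_of_monic hfQ (by rwa [aeval_map_algebraMap]) (hfmon.map _)).symm
      have hdvdQ : f.map (Int.castRingHom ℚ) ∣ P.map (Int.castRingHom ℚ) := by
        rw [← algebraMap_int_eq, ← hmin]
        exact minpoly.dvd ℚ z (by rwa [aeval_map_algebraMap])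
      have hdvd : f ∣ P := (IsPrimitive.Int.dvd_iff_map_cast_dvd_map_cast f P hfmon.isPrimitive).2 hdvdQ
      obtain ⟨P₁, hP₁⟩ := hdvd
      have hP₁mon : P₁.Monic := hfmon.of_mul_monic_left (hP₁ ▸ hPmon)
      have hdeg₁ : P₁.natDegree < n := by
        have h := congrArg natDegree hP₁
        rw [hfmon.natDegree_mul hP₁mon, hPn] at h
        omega
      have hroots₁ : ∀ w : ℂ, w ∈ (P₁.map (Int.castRingHom ℂ)).roots → aeval w f = 0 := by
        intro w hw
        apply hroots w
        rw [hP₁, Polynomial.map_mul]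
        exact Multiset.mem_of_le (roots.le_of_dvd (by rw [← Polynomial.map_mul, ← hP₁]; exact hPC0)
          (dvd_mul_left _ _)) hw
      obtain ⟨e, he⟩ := ih _ (hPn ▸ hdeg₁) P₁ rfl hP₁mon hroots₁
      exact ⟨e + 1, by rw [hP₁, he, pow_succ']⟩

/-- The polynomial `∏_μ (X - g(μ))` over the primitive `m`-th roots of unity has integer coefficients. -/
theorem prod_X_sub_C_aeval_primitiveRoots_lifts {m : ℕ} (hm : 0 < m) (g : ℤ[X]) :
    (∏ μ ∈ primitiveRoots m ℂ, (X - C (aeval μ g))) ∈ Polynomial.lifts (Int.castRingHom ℂ) := by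
  classical
  set Φ : ℤ[X] := cyclotomic m ℤ with hΦ
  have hΦmon : Φ.Monic := cyclotomic.monic m ℤ
  set ζ₀ : ℂ := Complex.exp (2 * Real.pi * Complex.I / m) with hζ₀def
  have hζ₀ : IsPrimitiveRoot ζ₀ m := Complex.isPrimitiveRoot_exp m hm.ne'
  have hroots : (Φ.map (Int.castRingHom ℂ)).roots = (primitiveRoots m ℂ).val := by
    rw [hΦ, map_cyclotomic_int, cyclotomic_eq_prod_X_sub_primitiveRoots hζ₀, roots_prod_X_sub_C]
  -- the roots of `Φ_m` enumerated by the subtype `σ` of `primitiveRoots m ℂ`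
  have hα : (Finset.univ.val.map (Subtype.val : (primitiveRoots m ℂ) → ℂ) : Multiset ℂ) =
      (Φ.map (Int.castRingHom ℂ)).roots := by
    rw [hroots]
    have h := congrArg Finset.val (Finset.attach_map_val (s := primitiveRoots m ℂ))
    rw [Finset.map_val, Function.Embedding.coe_subtype, ← Finset.univ_eq_attach] at h
    exact h
  -- the generic polynomial `Q = ∏_i (X - g(X_i))` over `MvPolynomial σ ℤ`
  set Q : Polynomial (MvPolynomial (primitiveRoots m ℂ) ℤ) :=
    ∏ i : (primitiveRoots m ℂ), (X - C (aeval (MvPolynomial.X i : MvPolynomial (primitiveRoots m ℂ) ℤ) g)) with hQ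
  have hQsymm : ∀ k : ℕ, (Q.coeff k).IsSymmetric := by
    intro k e
    have hmap : Q.map (MvPolynomial.rename e).toRingHom = Q := by
      rw [hQ, Polynomial.map_prod]
      simp only [Polynomial.map_sub, Polynomial.map_X, Polynomial.map_C, AlgHom.toRingHom_eq_coe, RingHom.coe_coe]
      have h1 : ∀ i : (primitiveRoots m ℂ), (MvPolynomial.rename e)
          (aeval (MvPolynomial.X i : MvPolynomial (primitiveRoots m ℂ) ℤ) g) =
          aeval (MvPolynomial.X (e i) : MvPolynomial (primitiveRoots m ℂ) ℤ) g := by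
        intro i
        rw [← Polynomial.aeval_algHom_apply, MvPolynomial.rename_X]
      simp_rw [h1]
      exact Fintype.prod_equiv e _
        (fun i => X - C (aeval (MvPolynomial.X i : MvPolynomial (primitiveRoots m ℂ) ℤ) g)) (fun i => rfl)
    have h := congrArg (fun R => R.coeff k) hmap
    simp only [Polynomial.coeff_map, AlgHom.toRingHom_eq_coe, RingHom.coe_coe] at h
    exact h
  have hQeval : Q.map (MvPolynomial.aeval (Subtype.val : (primitiveRoots m ℂ) → ℂ)).toRingHom =
      ∏ μ ∈ primitiveRoots m ℂ, (X - C (aeval μ g)) := by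
    rw [hQ, Polynomial.map_prod]
    simp only [Polynomial.map_sub, Polynomial.map_X, Polynomial.map_C, AlgHom.toRingHom_eq_coe, RingHom.coe_coe]
    have h1 : ∀ i : (primitiveRoots m ℂ), (MvPolynomial.aeval (Subtype.val : (primitiveRoots m ℂ) → ℂ))
        (aeval (MvPolynomial.X i : MvPolynomial (primitiveRoots m ℂ) ℤ) g) = aeval (i : ℂ) g := by
      intro i
      rw [← Polynomial.aeval_algHom_apply, MvPolynomial.aeval_X]
    simp_rw [h1]
    exact Finset.prod_coe_sort (primitiveRoots m ℂ) (fun μ => X - C (aeval μ g))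
  rw [lifts_iff_coeff_lifts]
  intro k
  obtain ⟨z, hz⟩ := exists_int_eq_aeval_of_isSymmetric Φ hΦmon (Subtype.val : (primitiveRoots m ℂ) → ℂ) hα
    (Q.coeff k) (hQsymm k)
  refine ⟨z, ?_⟩
  rw [← hQeval, Polynomial.coeff_map, AlgHom.toRingHom_eq_coe, RingHom.coe_coe, hz, eq_intCast]

/-- **[BombieriGubler2001, Theorem 4.4.9, Case I] in Mahler-measure form.**  Let `ζ ∈ ℂ` be a primitive `m`-th root
of unity, `g ∈ ℤ[X]`, `α = g(ζ)` neither `0` nor a root of unity, and `p` a prime not dividing `m`.  Then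
`(p/2)^{deg α} ≤ M(α)^{p+1}`, where `M(α) = M(minpoly_ℤ α)` and `deg α = deg minpoly_ℤ α`. -/
theorem cyclotomicInteger_lehmer_bound {m p : ℕ} (hm : 0 < m) (hp : p.Prime) (hcop : p.Coprime m) (g : ℤ[X])
    {ζ : ℂ} (hζ : IsPrimitiveRoot ζ m) (h0 : aeval ζ g ≠ 0) (hnu : ∀ k : ℕ, 0 < k → aeval ζ g ^ k ≠ 1) :
    ((p : ℝ) / 2) ^ (minpoly ℤ (aeval ζ g)).natDegree ≤ intMahlerMeasure (minpoly ℤ (aeval ζ g)) ^ (p + 1) := by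
  classical
  set α : ℂ := aeval ζ g with hα
  have hζint : IsIntegral ℤ ζ := hζ.isIntegral hm
  have hαint : IsIntegral ℤ α := by
    have hmem : α ∈ Algebra.adjoin ℤ {ζ} := by
      rw [hα]
      exact Polynomial.aeval_mem_adjoin_singleton ℤ ζ
    exact (mem_integralClosure_iff ℤ ℂ).1 (adjoin_le_integralClosure hζint hmem)
  set f : ℤ[X] := minpoly ℤ α with hf
  have hfmon : f.Monic := minpoly.monic hαint
  have hfirr : Irreducible f := minpoly.irreducible hαint
  have hfdeg : 0 < f.natDegree := minpoly.natDegree_pos hαint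
  -- (1) every `g(μ)` is a root of `f`
  have hroot : ∀ μ : ℂ, IsPrimitiveRoot μ m → aeval (aeval μ g) f = 0 := by
    intro μ hμ
    have h1 : aeval ζ (f.comp g) = 0 := by rw [aeval_comp, hf, minpoly.aeval]
    have h2 := aeval_eq_zero_of_primitiveRoot hm hζ h1 hμ
    rwa [aeval_comp] at h2
  -- (2) the integer polynomial `F` with `F = ∏_μ (X - g(μ))` over `ℂ`
  set Fc : ℂ[X] := ∏ μ ∈ primitiveRoots m ℂ, (X - C (aeval μ g)) with hFc
  have hFcmon : Fc.Monic := monic_prod_of_monic _ _ (fun _ _ => monic_X_sub_C _)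
  obtain ⟨F, hFmap, hFdeg, hFmon⟩ :=
    lifts_and_natDegree_eq_and_monic (prod_X_sub_C_aeval_primitiveRoots_lifts hm g) hFcmon
  have hFcdeg : Fc.natDegree = m.totient := by
    rw [hFc, natDegree_prod_of_monic _ _ (fun _ _ => monic_X_sub_C _)]
    simp only [natDegree_X_sub_C, Finset.sum_const, smul_eq_mul, mul_one]
    exact (Complex.isPrimitiveRoot_exp m hm.ne').card_primitiveRoots
  -- (3) `F = f^e`
  have hFroots : ∀ z : ℂ, z ∈ (F.map (Int.castRingHom ℂ)).roots → aeval z f = 0 := by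
    intro z hz
    have hmm : ((primitiveRoots m ℂ).val.map fun μ => X - C (aeval μ g)) =
        (((primitiveRoots m ℂ).val.map fun μ => aeval μ g).map fun a : ℂ => X - C a) := by
      rw [Multiset.map_map]
      rfl
    rw [hFmap, Finset.prod_eq_multiset_prod, hmm, roots_multiset_prod_X_sub_C, Multiset.mem_map] at hz
    obtain ⟨μ, hμ, rfl⟩ := hz
    exact hroot μ ((mem_primitiveRoots hm).1 (Finset.mem_def.2 hμ))
  obtain ⟨e, hFe⟩ := eq_pow_of_roots_subset hfmon hfirr _ F rfl hFmon hFroots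
  have hed : e * f.natDegree = m.totient := by
    rw [← hFcdeg, ← hFdeg, hFe, natDegree_pow]
  have he0 : e ≠ 0 := by
    intro he
    rw [he, zero_mul] at hed
    exact (Nat.totient_pos.2 hm).ne' hed.symm
  -- (4) measures
  have hMF : intMahlerMeasure F = ∏ μ ∈ primitiveRoots m ℂ, max 1 ‖aeval μ g‖ := by
    unfold intMahlerMeasure
    rw [hFmap, mahlerMeasure_prod_X_sub_C]
  have hMFe : intMahlerMeasure F = intMahlerMeasure f ^ e := by rw [hFe, intMahlerMeasure_pow]
  -- (5) the bound
  have hsep := pow_ne_aeval_pow_of_not_torsion hm hp hcop g hζ h0 hnu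
  have hB := cyclotomicInteger_measure_bound hm hp hcop g hsep
  rw [← hMF, hMFe, ← hed, ← pow_mul, mul_comm e, pow_mul, pow_mul, ← pow_mul (intMahlerMeasure f) e,
    mul_comm e (p + 1), pow_mul] at hB
  have hM0 : 0 ≤ intMahlerMeasure f := le_trans zero_le_one (one_le_intMahlerMeasure hfmon.ne_zero)
  exact (pow_le_pow_iff_left₀ (by positivity) (by positivity) he0).1 hB

/-- A cyclotomic (indeed any) algebraic integer of degree `1` which is neither `0` nor a root of unity is a rational
integer of modulus `≥ 2`, so its Mahler measure is `≥ 2`. -/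
theorem two_le_measure_of_natDegree_minpoly_eq_one {α : ℂ} (hαint : IsIntegral ℤ α) (h0 : α ≠ 0)
    (hnu : ∀ k : ℕ, 0 < k → α ^ k ≠ 1) (hd : (minpoly ℤ α).natDegree = 1) :
    2 ≤ intMahlerMeasure (minpoly ℤ α) := by
  have hmon := minpoly.monic hαint
  have hf1 := hmon.eq_X_add_C hd
  set c : ℤ := (minpoly ℤ α).coeff 0 with hc
  have hαc : α = -(c : ℂ) := by
    have h := minpoly.aeval ℤ α
    rw [hf1, map_add, aeval_X, aeval_C, algebraMap_int_eq, eq_intCast] at h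
    linear_combination h
  have hc0 : c ≠ 0 := by
    intro h; apply h0; rw [hαc, h]; simp
  have hc1 : c ≠ 1 := by
    intro h; apply hnu 2 (by norm_num); rw [hαc, h]; norm_num
  have hc2 : c ≠ -1 := by
    intro h; apply hnu 1 (by norm_num); rw [hαc, h]; norm_num
  have habs0 : 0 < |c| := abs_pos.2 hc0
  have habs1 : |c| ≠ 1 := fun h => by
    rcases abs_eq (by norm_num : (0 : ℤ) ≤ 1) |>.1 h with h' | h'
    · exact hc1 h'
    · exact hc2 h'
  have hcabs : (2 : ℤ) ≤ |c| := by omega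
  have hMge : ‖α‖ ≤ intMahlerMeasure (minpoly ℤ α) := norm_root_le_intMahlerMeasure hmon (minpoly.aeval ℤ α)
  have hnorm : ‖α‖ = |(c : ℝ)| := by rw [hαc, norm_neg, Complex.norm_intCast]
  rw [hnorm] at hMge
  have h2 : (2 : ℝ) ≤ |(c : ℝ)| := by
    rw [← Int.cast_abs]; exact_mod_cast hcabs
  linarith

/-- **Lehmer's conjecture for cyclotomic integers of conductor prime to a small prime.**  If `ζ` is a primitive
`m`-th root of unity, `p ∤ m` is a prime with `1.17629^{p+1} < (p/2)²` (true for `p = 3, 5, 7, …, 31`), and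
`α = g(ζ)`, `g ∈ ℤ[X]`, is neither `0` nor a root of unity, then `M(α) > M(ℓ)`, Lehmer's number `1.17628…`. -/
theorem lehmer_of_cyclotomicInteger {m p : ℕ} (hm : 0 < m) (hp : p.Prime) (hcop : p.Coprime m)
    (hnum : ((117629 : ℝ) / 100000) ^ (p + 1) < ((p : ℝ) / 2) ^ 2) (g : ℤ[X]) {ζ : ℂ}
    (hζ : IsPrimitiveRoot ζ m) (h0 : aeval ζ g ≠ 0) (hnu : ∀ k : ℕ, 0 < k → aeval ζ g ^ k ≠ 1) :
    intMahlerMeasure lehmerPoly < intMahlerMeasure (minpoly ℤ (aeval ζ g)) := by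
  have hB := cyclotomicInteger_lehmer_bound hm hp hcop g hζ h0 hnu
  have hL := lehmer_measure_upper_bound
  set M := intMahlerMeasure (minpoly ℤ (aeval ζ g)) with hM
  set d := (minpoly ℤ (aeval ζ g)).natDegree with hd
  have hζint : IsIntegral ℤ ζ := hζ.isIntegral hm
  have hαint : IsIntegral ℤ (aeval ζ g) := by
    have hmem : aeval ζ g ∈ Algebra.adjoin ℤ {ζ} := Polynomial.aeval_mem_adjoin_singleton ℤ ζ
    exact (mem_integralClosure_iff ℤ ℂ).1 (adjoin_le_integralClosure hζint hmem)
  have hdpos : 0 < d := minpoly.natDegree_pos hαint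
  have hM1 : 1 ≤ M := one_le_intMahlerMeasure (minpoly.monic hαint).ne_zero
  have hL0 : 0 ≤ intMahlerMeasure lehmerPoly :=
    le_trans zero_le_one (one_le_intMahlerMeasure lehmerPoly_monic.ne_zero)
  rcases Nat.lt_or_ge d 2 with hd1 | hd2
  · have h2 := two_le_measure_of_natDegree_minpoly_eq_one hαint h0 hnu (show (minpoly ℤ (aeval ζ g)).natDegree = 1 by
      rw [← hd]; omega)
    linarith
  · have hp2 : (1 : ℝ) ≤ (p : ℝ) / 2 := by
      have : (2 : ℝ) ≤ p := by exact_mod_cast hp.two_le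
      linarith
    have hsq : ((p : ℝ) / 2) ^ 2 ≤ M ^ (p + 1) :=
      (pow_le_pow_right₀ hp2 hd2).trans hB
    by_contra hle
    push Not at hle
    have h1 := pow_le_pow_left₀ (le_trans zero_le_one hM1) hle (p + 1)
    have h2 := pow_le_pow_left₀ hL0 hL.le (p + 1)
    linarith

/-- **Lehmer's conjecture for the cyclotomic integers of `ℚ(ζ_m)`, `3 ∤ m`** (`M(α)^4 ≥ (3/2)^{deg α}`;
in degree `≥ 2` this is `M(α) ≥ (9/4)^{1/4} = 1.2247…`). -/
theorem lehmer_of_cyclotomicInteger_three {m : ℕ} (hm : 0 < m) (h3 : ¬ 3 ∣ m) (g : ℤ[X]) {ζ : ℂ}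
    (hζ : IsPrimitiveRoot ζ m) (h0 : aeval ζ g ≠ 0) (hnu : ∀ k : ℕ, 0 < k → aeval ζ g ^ k ≠ 1) :
    intMahlerMeasure lehmerPoly < intMahlerMeasure (minpoly ℤ (aeval ζ g)) :=
  lehmer_of_cyclotomicInteger hm Nat.prime_three ((Nat.Prime.coprime_iff_not_dvd Nat.prime_three).2 h3)
    (by norm_num) g hζ h0 hnu

/-- **Lehmer's conjecture for the cyclotomic integers of `ℚ(ζ_m)`, `5 ∤ m`** (`M(α)^6 ≥ (5/2)^{deg α}`). -/
theorem lehmer_of_cyclotomicInteger_five {m : ℕ} (hm : 0 < m) (h5 : ¬ 5 ∣ m) (g : ℤ[X]) {ζ : ℂ}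
    (hζ : IsPrimitiveRoot ζ m) (h0 : aeval ζ g ≠ 0) (hnu : ∀ k : ℕ, 0 < k → aeval ζ g ^ k ≠ 1) :
    intMahlerMeasure lehmerPoly < intMahlerMeasure (minpoly ℤ (aeval ζ g)) :=
  lehmer_of_cyclotomicInteger hm Nat.prime_five ((Nat.Prime.coprime_iff_not_dvd Nat.prime_five).2 h5)
    (by norm_num) g hζ h0 hnu

/-- … and `31 ∤ m` (the largest prime for which the exponent bound beats Lehmer's number in degree `2`). -/
theorem lehmer_of_cyclotomicInteger_thirtyone {m : ℕ} (hm : 0 < m) (h31 : ¬ 31 ∣ m) (g : ℤ[X]) {ζ : ℂ}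
    (hζ : IsPrimitiveRoot ζ m) (h0 : aeval ζ g ≠ 0) (hnu : ∀ k : ℕ, 0 < k → aeval ζ g ^ k ≠ 1) :
    intMahlerMeasure lehmerPoly < intMahlerMeasure (minpoly ℤ (aeval ζ g)) :=
  lehmer_of_cyclotomicInteger hm (by norm_num) ((Nat.Prime.coprime_iff_not_dvd (by norm_num)).2 h31)
    (by norm_num) g hζ h0 hnu

end Summit.Ventures.DiscreteObjects.Mahler
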